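import Mathlib
import Summits.Ventures.PercRepro2.Defs
import Summits.Ventures.PercRepro2.Independence
import Summits.Ventures.PercRepro2.Harris
import Summits.Ventures.PercRepro2.ZCTwoEdge

/-!
# (ZC) when `o` has no neighbour outside `{a₁, a₃}` — the third two-edge theorem (Theorem D)
(blind cell PercRepro2, mine-a g23; MINE-A.md §70.2)

The four-mark inequality (ZC) of MINE-A.md §66,
`P(D) · Cov(U, eL) ≥ P(B) · Cov(U, e¬L)`  (`e = {a₃ ∈ C₁}`, `L = {o ∈ C₁}`, `U = {C₁ ∈ 𝒰}`,
`B = [a₁ | a₃o]`, `D = [a₁ | a₃ | o]`), is proved here for every graph in which the mark `o` is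
joined to the rest only through the two edges `f₁ = oa₁` and `f₂ = oa₃` — with Theorem A
(`zc_two_edge`, the root `a₁` of degree two) and Theorem C (`zc_a3_two_edge`, the mark `a₃` of
degree two) this completes the three «one mark of degree ≤ 2 inside the marks» classes.

The statement is abstract: `A'` is the event `{a₁ ↔ a₃}` of the graph `G − o` (it ignores `f₁`,
`f₂`), and `X₀ ⊆ X₁ ⊆ X₃` are the events `{C(a₁) ∈ 𝒰}`, `{C(a₁) ∪ {o} ∈ 𝒰}`,
`{C(a₁) ∪ C(a₃) ∪ {o} ∈ 𝒰}` of `G − o` (ignoring `f₁`, `f₂`; `X₃` increasing; on `A'` the clusters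
of `a₁` and `a₃` coincide, so `X₁ ∩ A' = X₃ ∩ A'`).  In that graph
`e = A' ∪ {f₁, f₂ open}`, `L = {f₁ open} ∪ ({f₂ open} ∩ A')`, `{a₃ ↔ o} = {f₂ open} ∪ ({f₁ open} ∩ A')`,
and `U = ({f₁, f₂ open} ∩ X₃) ∪ (L ∩ {f₁, f₂ open}ᶜ ∩ X₁) ∪ (Lᶜ ∩ X₀)` — nothing else about the
graph is used.

The proof: expand every probability over the four states of `(f₁, f₂)` (`prob_two_pin`), so that
everything is a polynomial in `q = p f₁`, `r = p f₂`, `μ = P(A')`, `a = P(X₃ ∩ A')`,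
`z = P(X₃ ∩ A'ᶜ)`, `b = P(X₁ ∩ A'ᶜ)`, `c = P(X₀ ∩ A')`, `d = P(X₀ ∩ A'ᶜ)`; ONE Harris inequality in
`G − o` (`X₃` and `A'` increasing) gives `(1 − μ) a ≥ μ z`; monotonicity gives `d ≤ b ≤ z`, `c ≤ a`;
and the polynomial identity
`(ZC) = (1−q)(1−r)(1−μ) · { q(1−r)[(1−μ)a − μz] + q(μ + (1−μ)r)[(a + z) − P(U)] + (1−q) r (a − c) }`
(`(a + z) − P(U) = q(1−r)(z−b) + (1−q)r(z−d) + (1−q)(1−r)(a+z−c−d)`) exhibits the slack as a sum of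
products of nonnegative factors.  One seat; every identity twinned in exact rational arithmetic
(data/mine-a/g23/codes/twin_cd.py, 350 cells).
-/

namespace Summit.Ventures.PercRepro2

section OTwoEdgeTheorem

variable {E : Type*} [Fintype E] [DecidableEq E] {R : Type*} [CommRing R] [LinearOrder R]
  [IsStrictOrderedRing R]

/-- The algebraic core of Theorem D: with `q = p f₁`, `r = p f₂`, `μ = P(A')`, `a = P(X₃ ∩ A')`,
`z = P(X₃ ∩ A'ᶜ)`, `b = P(X₁ ∩ A'ᶜ)`, `c = P(X₀ ∩ A')`, `d = P(X₀ ∩ A'ᶜ)`, the (ZC) expression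
minus the explicit bound `(1−q)(1−r)(1−μ)·[q(1−r)((1−μ)a − μz) + (1−q)r(a − c)]` equals
`(1−q)(1−r)(1−μ)·q·(μ + (1−μ)r)·[(a + z) − P(U)]`, a product of nonnegative factors. -/
lemma zc_o_two_edge_alg (q r μ a z b c d : R) (hq : 0 ≤ q) (hq' : q ≤ 1) (hr : 0 ≤ r)
    (hr' : r ≤ 1) (hμ0 : 0 ≤ μ) (hμ1 : μ ≤ 1) (hzb : b ≤ z) (hdb : d ≤ b) (hca : c ≤ a) :
    (1 - q) * (1 - r) * (1 - μ) *
      (q * r * (a + z) + q * (1 - r) * a + (1 - q) * r * a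
        - (q * r * (a + z) + q * (1 - r) * (a + b) + (1 - q) * r * (a + d)
            + (1 - q) * (1 - r) * (c + d))
          * (q * r + q * (1 - r) * μ + (1 - q) * r * μ))
      - (1 - q) * r * (1 - μ) *
        ((1 - q) * (1 - r) * c
          - (q * r * (a + z) + q * (1 - r) * (a + b) + (1 - q) * r * (a + d)
              + (1 - q) * (1 - r) * (c + d))
            * ((1 - q) * (1 - r) * μ))
      ≥ (1 - q) * (1 - r) * (1 - μ) *
          (q * (1 - r) * ((1 - μ) * a - μ * z) + (1 - q) * r * (a - c)) := by
  have h1q : 0 ≤ 1 - q := sub_nonneg.2 hq'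
  have h1r : 0 ≤ 1 - r := sub_nonneg.2 hr'
  have h1μ : 0 ≤ 1 - μ := sub_nonneg.2 hμ1
  have hA : 0 ≤ μ + (1 - μ) * r := add_nonneg hμ0 (mul_nonneg h1μ hr)
  have hdz : d ≤ z := le_trans hdb hzb
  have hmono : 0 ≤ q * (1 - r) * (z - b) + (1 - q) * r * (z - d)
      + (1 - q) * (1 - r) * ((a - c) + (z - d)) :=
    add_nonneg (add_nonneg (mul_nonneg (mul_nonneg hq h1r) (sub_nonneg.2 hzb))
      (mul_nonneg (mul_nonneg h1q hr) (sub_nonneg.2 hdz)))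
      (mul_nonneg (mul_nonneg h1q h1r) (add_nonneg (sub_nonneg.2 hca) (sub_nonneg.2 hdz)))
  have hnn : 0 ≤ (1 - q) * (1 - r) * (1 - μ) * q * (μ + (1 - μ) * r) *
      (q * (1 - r) * (z - b) + (1 - q) * r * (z - d)
        + (1 - q) * (1 - r) * ((a - c) + (z - d))) :=
    mul_nonneg (mul_nonneg (mul_nonneg (mul_nonneg (mul_nonneg h1q h1r) h1μ) hq) hA) hmono
  have key : (1 - q) * (1 - r) * (1 - μ) *
      (q * r * (a + z) + q * (1 - r) * a + (1 - q) * r * a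
        - (q * r * (a + z) + q * (1 - r) * (a + b) + (1 - q) * r * (a + d)
            + (1 - q) * (1 - r) * (c + d))
          * (q * r + q * (1 - r) * μ + (1 - q) * r * μ))
      - (1 - q) * r * (1 - μ) *
        ((1 - q) * (1 - r) * c
          - (q * r * (a + z) + q * (1 - r) * (a + b) + (1 - q) * r * (a + d)
              + (1 - q) * (1 - r) * (c + d))
            * ((1 - q) * (1 - r) * μ))
      - (1 - q) * (1 - r) * (1 - μ) *
          (q * (1 - r) * ((1 - μ) * a - μ * z) + (1 - q) * r * (a - c))
      = (1 - q) * (1 - r) * (1 - μ) * q * (μ + (1 - μ) * r) *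
      (q * (1 - r) * (z - b) + (1 - q) * r * (z - d)
        + (1 - q) * (1 - r) * ((a - c) + (z - d))) := by ring
  linarith [key, hnn]

/-- **Theorem D (MINE-A.md §70.2)** — (ZC) for every graph in which the mark `o` is joined to the
rest only by the two edges `f₁ = oa₁` (weight `p f₁`) and `f₂ = oa₃` (weight `p f₂`), for every
cluster up-set: with `e`, `L`, `U`, `γ` as above and `B = eᶜ ∩ Lᶜ ∩ γ`, `D = eᶜ ∩ Lᶜ ∩ γᶜ`,
  `P(D) · (P(U ∩ e ∩ L) − P(U) P(e ∩ L)) − P(B) · (P(U ∩ e ∩ Lᶜ) − P(U) P(e ∩ Lᶜ))`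
  `≥ (1 − p f₁)(1 − p f₂)(1 − μ) · [p f₁ (1 − p f₂) ((1 − μ) P(X₃ ∩ A') − μ P(X₃ ∩ A'ᶜ)) + (1 − p f₁) p f₂ (P(X₁ ∩ A') − P(X₀ ∩ A'))]`,
`μ = P(A')`.
Inputs: `A'`, `X₀`, `X₁`, `X₃` ignore `f₁`, `f₂` (membership is invariant under forcing them);
`X₁ ∩ A' = X₃ ∩ A'` (on `a₁ ↔ a₃` the two glued clusters coincide); `X₀ ⊆ X₁ ⊆ X₃` (monotonicity
of the up-set).  This exact lower bound needs no Harris inequality; the sign of the bound (hence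
of (ZC)) is the ONE Harris inequality `(1 − μ) P(X₃ ∩ A') ≥ μ P(X₃ ∩ A'ᶜ)` between the increasing
events `X₃` and `A'` of `G − o` — `zc_o_two_edge_nonneg`. -/
theorem zc_o_two_edge {p : E → R} (hp : IsProbVec p) {f₁ f₂ : E} (hf : f₁ ≠ f₂)
    {A' X₀ X₁ X₃ : Set (Config E)}
    (hA' : ∀ (ω : Config E) (b₁ b₂ : Bool),
      Function.update (Function.update ω f₁ b₁) f₂ b₂ ∈ A' ↔ ω ∈ A')
    (hX₀ : ∀ (ω : Config E) (b₁ b₂ : Bool),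
      Function.update (Function.update ω f₁ b₁) f₂ b₂ ∈ X₀ ↔ ω ∈ X₀)
    (hX₁ : ∀ (ω : Config E) (b₁ b₂ : Bool),
      Function.update (Function.update ω f₁ b₁) f₂ b₂ ∈ X₁ ↔ ω ∈ X₁)
    (hX₃ : ∀ (ω : Config E) (b₁ b₂ : Bool),
      Function.update (Function.update ω f₁ b₁) f₂ b₂ ∈ X₃ ↔ ω ∈ X₃)
    (h13 : X₁ ∩ A' = X₃ ∩ A') (h01 : X₀ ⊆ X₁) (h13s : X₁ ⊆ X₃) :
    let e := A' ∪ (openEdge f₁ ∩ openEdge f₂)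
    let L := openEdge f₁ ∪ (openEdge f₂ ∩ A')
    let U := (openEdge f₁ ∩ openEdge f₂ ∩ X₃) ∪ (L ∩ (openEdge f₁ ∩ openEdge f₂)ᶜ ∩ X₁)
      ∪ (Lᶜ ∩ X₀)
    let γ := openEdge f₂ ∪ (openEdge f₁ ∩ A')
    prob p (eᶜ ∩ Lᶜ ∩ γᶜ) * (prob p (U ∩ (e ∩ L)) - prob p U * prob p (e ∩ L))
      - prob p (eᶜ ∩ Lᶜ ∩ γ) * (prob p (U ∩ (e ∩ Lᶜ)) - prob p U * prob p (e ∩ Lᶜ))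
      ≥ (1 - p f₁) * (1 - p f₂) * (1 - prob p A') *
          (p f₁ * (1 - p f₂)
              * ((1 - prob p A') * prob p (X₃ ∩ A') - prob p A' * prob p (X₃ ∩ A'ᶜ))
            + (1 - p f₁) * p f₂ * (prob p (X₁ ∩ A') - prob p (X₀ ∩ A'))) := by
  intro e L U γ
  -- the forced events
  have hs1 := update2_fst hf
  -- closed forms of the seven probabilities
  set μ := prob p A' with hμ
  set a := prob p (X₃ ∩ A') with ha
  set z := prob p (X₃ ∩ A'ᶜ) with hz
  set b := prob p (X₁ ∩ A'ᶜ) with hb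
  set c := prob p (X₀ ∩ A') with hc
  set d := prob p (X₀ ∩ A'ᶜ) with hd
  have hX3 : prob p X₃ = a + z := (prob_inter_add_prob_inter_compl p X₃ A').symm
  have hX1 : prob p X₁ = a + b := by
    rw [← prob_inter_add_prob_inter_compl p X₁ A', h13]
  have hX0 : prob p X₀ = c + d := (prob_inter_add_prob_inter_compl p X₀ A').symm
  have hX1A : prob p (X₁ ∩ A') = a := by rw [h13]
  have hAc : prob p A'ᶜ = 1 - μ := prob_compl p A'
  -- the mixed cell `(f₁ closed, f₂ open)`: `U = (A' ∩ X₁) ∪ (A'ᶜ ∩ X₀)`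
  have hmix : prob p ((A' ∩ X₁) ∪ (A'ᶜ ∩ X₀)) = a + d := by
    rw [← prob_inter_add_prob_inter_compl p ((A' ∩ X₁) ∪ (A'ᶜ ∩ X₀)) A']
    have e1 : ((A' ∩ X₁) ∪ (A'ᶜ ∩ X₀)) ∩ A' = X₁ ∩ A' := by
      ext ω; simp only [Set.mem_inter_iff, Set.mem_union, Set.mem_compl_iff]; tauto
    have e2 : ((A' ∩ X₁) ∪ (A'ᶜ ∩ X₀)) ∩ A'ᶜ = X₀ ∩ A'ᶜ := by
      ext ω; simp only [Set.mem_inter_iff, Set.mem_union, Set.mem_compl_iff]; tauto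
    rw [e1, e2, hX1A]
  have PeL : prob p (e ∩ L) = p f₁ * p f₂ + p f₁ * (1 - p f₂) * μ + (1 - p f₁) * p f₂ * μ := by
    rw [prob_two_pin p hf]
    have e11 : {ω | Function.update (Function.update ω f₁ true) f₂ true ∈ (e ∩ L)} = Set.univ := by
      ext ω; simp [e, L, hs1, hA']
    have e10 : {ω | Function.update (Function.update ω f₁ true) f₂ false ∈ (e ∩ L)} = A' := by
      ext ω; simp [e, L, hs1, hA']
    have e01 : {ω | Function.update (Function.update ω f₁ false) f₂ true ∈ (e ∩ L)} = A' := by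
      ext ω; simp [e, L, hs1, hA']
    have e00 : {ω | Function.update (Function.update ω f₁ false) f₂ false ∈ (e ∩ L)} = ∅ := by
      ext ω; simp [e, L, hs1, hA']
    rw [e11, e10, e01, e00, prob_univ, prob_empty]; ring
  have PUeL : prob p (U ∩ (e ∩ L)) = p f₁ * p f₂ * (a + z) + p f₁ * (1 - p f₂) * a
      + (1 - p f₁) * p f₂ * a := by
    rw [prob_two_pin p hf]
    have e11 : {ω | Function.update (Function.update ω f₁ true) f₂ true ∈ (U ∩ (e ∩ L))} = X₃ := by
      ext ω; simp [e, L, U, hs1, hA', hX₃]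
    have e10 : {ω | Function.update (Function.update ω f₁ true) f₂ false ∈ (U ∩ (e ∩ L))} = X₁ ∩ A' := by
      ext ω; simp [e, L, U, hs1, hA', hX₁]
    have e01 : {ω | Function.update (Function.update ω f₁ false) f₂ true ∈ (U ∩ (e ∩ L))} = X₁ ∩ A' := by
      ext ω; simp [e, L, U, hs1, hA', hX₁, hX₀]; tauto
    have e00 : {ω | Function.update (Function.update ω f₁ false) f₂ false ∈ (U ∩ (e ∩ L))} = ∅ := by
      ext ω; simp [e, L, U, hs1, hA']
    rw [e11, e10, e01, e00, prob_empty, hX3, hX1A]; ring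
  have PenL : prob p (e ∩ Lᶜ) = (1 - p f₁) * (1 - p f₂) * μ := by
    rw [prob_two_pin p hf]
    have e11 : {ω | Function.update (Function.update ω f₁ true) f₂ true ∈ (e ∩ Lᶜ)} = ∅ := by
      ext ω; simp [e, L, hs1]
    have e10 : {ω | Function.update (Function.update ω f₁ true) f₂ false ∈ (e ∩ Lᶜ)} = ∅ := by
      ext ω; simp [e, L, hs1]
    have e01 : {ω | Function.update (Function.update ω f₁ false) f₂ true ∈ (e ∩ Lᶜ)} = ∅ := by
      ext ω; simp [e, L, hs1, hA']
    have e00 : {ω | Function.update (Function.update ω f₁ false) f₂ false ∈ (e ∩ Lᶜ)} = A' := by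
      ext ω; simp [e, L, hs1, hA']
    rw [e11, e10, e01, e00, prob_empty]; ring
  have PUenL : prob p (U ∩ (e ∩ Lᶜ)) = (1 - p f₁) * (1 - p f₂) * c := by
    rw [prob_two_pin p hf]
    have e11 : {ω | Function.update (Function.update ω f₁ true) f₂ true ∈ (U ∩ (e ∩ Lᶜ))} = ∅ := by
      ext ω; simp [e, L, U, hs1]
    have e10 : {ω | Function.update (Function.update ω f₁ true) f₂ false ∈ (U ∩ (e ∩ Lᶜ))} = ∅ := by
      ext ω; simp [e, L, U, hs1]
    have e01 : {ω | Function.update (Function.update ω f₁ false) f₂ true ∈ (U ∩ (e ∩ Lᶜ))} = ∅ := by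
      ext ω; simp [e, L, U, hs1, hA']
    have e00 : {ω | Function.update (Function.update ω f₁ false) f₂ false ∈ (U ∩ (e ∩ Lᶜ))} = X₀ ∩ A' := by
      ext ω; simp [e, L, U, hs1, hA', hX₀]
    rw [e11, e10, e01, e00, prob_empty]; ring
  have PU : prob p U = p f₁ * p f₂ * (a + z) + p f₁ * (1 - p f₂) * (a + b)
      + (1 - p f₁) * p f₂ * (a + d) + (1 - p f₁) * (1 - p f₂) * (c + d) := by
    rw [prob_two_pin p hf]
    have e11 : {ω | Function.update (Function.update ω f₁ true) f₂ true ∈ U} = X₃ := by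
      ext ω; simp [L, U, hs1, hX₃]
    have e10 : {ω | Function.update (Function.update ω f₁ true) f₂ false ∈ U} = X₁ := by
      ext ω; simp [L, U, hs1, hX₁]
    have e01 : {ω | Function.update (Function.update ω f₁ false) f₂ true ∈ U} = (A' ∩ X₁) ∪ (A'ᶜ ∩ X₀) := by
      ext ω; simp [L, U, hs1, hA', hX₁, hX₀]
    have e00 : {ω | Function.update (Function.update ω f₁ false) f₂ false ∈ U} = X₀ := by
      ext ω; simp [L, U, hs1, hX₀]
    rw [e11, e10, e01, e00, hX3, hX1, hmix, hX0]
  have PB : prob p (eᶜ ∩ Lᶜ ∩ γ) = (1 - p f₁) * p f₂ * (1 - μ) := by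
    rw [prob_two_pin p hf]
    have e11 : {ω | Function.update (Function.update ω f₁ true) f₂ true ∈ (eᶜ ∩ Lᶜ ∩ γ)} = ∅ := by
      ext ω; simp [e, L, γ, hs1]
    have e10 : {ω | Function.update (Function.update ω f₁ true) f₂ false ∈ (eᶜ ∩ Lᶜ ∩ γ)} = ∅ := by
      ext ω; simp [e, L, γ, hs1]
    have e01 : {ω | Function.update (Function.update ω f₁ false) f₂ true ∈ (eᶜ ∩ Lᶜ ∩ γ)} = A'ᶜ := by
      ext ω; simp [e, L, γ, hs1, hA']
    have e00 : {ω | Function.update (Function.update ω f₁ false) f₂ false ∈ (eᶜ ∩ Lᶜ ∩ γ)} = ∅ := by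
      ext ω; simp [e, L, γ, hs1, hA']
    rw [e11, e10, e01, e00, prob_empty, hAc]; ring
  have PD : prob p (eᶜ ∩ Lᶜ ∩ γᶜ) = (1 - p f₁) * (1 - p f₂) * (1 - μ) := by
    rw [prob_two_pin p hf]
    have e11 : {ω | Function.update (Function.update ω f₁ true) f₂ true ∈ (eᶜ ∩ Lᶜ ∩ γᶜ)} = ∅ := by
      ext ω; simp [e, L, γ, hs1]
    have e10 : {ω | Function.update (Function.update ω f₁ true) f₂ false ∈ (eᶜ ∩ Lᶜ ∩ γᶜ)} = ∅ := by
      ext ω; simp [e, L, γ, hs1]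
    have e01 : {ω | Function.update (Function.update ω f₁ false) f₂ true ∈ (eᶜ ∩ Lᶜ ∩ γᶜ)} = ∅ := by
      ext ω; simp [e, L, γ, hs1]
    have e00 : {ω | Function.update (Function.update ω f₁ false) f₂ false ∈ (eᶜ ∩ Lᶜ ∩ γᶜ)} = A'ᶜ := by
      ext ω; simp [e, L, γ, hs1, hA']
    rw [e11, e10, e01, e00, prob_empty, hAc]; ring
  -- the probabilistic inputs (the Harris inequality enters through the explicit bound)
  have hzb : b ≤ z := prob_mono hp (Set.inter_subset_inter_left _ h13s)
  have hdb : d ≤ b := prob_mono hp (Set.inter_subset_inter_left _ h01)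
  have hca : c ≤ a := prob_mono hp (Set.inter_subset_inter_left _ (h01.trans h13s))
  have hμ0 : 0 ≤ μ := prob_nonneg hp _
  have hμ1 : μ ≤ 1 := prob_le_one hp _
  have hq := hp.nonneg f₁
  have hq' := hp.le_one f₁
  have hr := hp.nonneg f₂
  have hr' := hp.le_one f₂
  -- the algebra
  rw [PeL, PUeL, PenL, PUenL, PU, PB, PD, hX1A]
  exact zc_o_two_edge_alg (p f₁) (p f₂) μ a z b c d hq hq' hr hr' hμ0 hμ1 hzb hdb hca

/-- **Theorem D, the sign**: under the hypotheses of `zc_o_two_edge` and with `A'`, `X₃`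
increasing (one Harris inequality in `G − o`), (ZC) is nonnegative. -/
theorem zc_o_two_edge_nonneg {p : E → R} (hp : IsProbVec p) {f₁ f₂ : E} (hf : f₁ ≠ f₂)
    {A' X₀ X₁ X₃ : Set (Config E)}
    (hA' : ∀ (ω : Config E) (b₁ b₂ : Bool),
      Function.update (Function.update ω f₁ b₁) f₂ b₂ ∈ A' ↔ ω ∈ A')
    (hX₀ : ∀ (ω : Config E) (b₁ b₂ : Bool),
      Function.update (Function.update ω f₁ b₁) f₂ b₂ ∈ X₀ ↔ ω ∈ X₀)
    (hX₁ : ∀ (ω : Config E) (b₁ b₂ : Bool),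
      Function.update (Function.update ω f₁ b₁) f₂ b₂ ∈ X₁ ↔ ω ∈ X₁)
    (hX₃ : ∀ (ω : Config E) (b₁ b₂ : Bool),
      Function.update (Function.update ω f₁ b₁) f₂ b₂ ∈ X₃ ↔ ω ∈ X₃)
    (hA'up : IsUpperSet A') (hX₃up : IsUpperSet X₃)
    (h13 : X₁ ∩ A' = X₃ ∩ A') (h01 : X₀ ⊆ X₁) (h13s : X₁ ⊆ X₃) :
    let e := A' ∪ (openEdge f₁ ∩ openEdge f₂)
    let L := openEdge f₁ ∪ (openEdge f₂ ∩ A')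
    let U := (openEdge f₁ ∩ openEdge f₂ ∩ X₃) ∪ (L ∩ (openEdge f₁ ∩ openEdge f₂)ᶜ ∩ X₁)
      ∪ (Lᶜ ∩ X₀)
    let γ := openEdge f₂ ∪ (openEdge f₁ ∩ A')
    0 ≤ prob p (eᶜ ∩ Lᶜ ∩ γᶜ) * (prob p (U ∩ (e ∩ L)) - prob p U * prob p (e ∩ L))
      - prob p (eᶜ ∩ Lᶜ ∩ γ) * (prob p (U ∩ (e ∩ Lᶜ)) - prob p U * prob p (e ∩ Lᶜ)) := by
  intro e L U γ
  have h := zc_o_two_edge hp hf hA' hX₀ hX₁ hX₃ h13 h01 h13s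
  simp only at h
  refine le_trans ?_ h
  have hHar : (prob p (X₃ ∩ A') + prob p (X₃ ∩ A'ᶜ)) * prob p A' ≤ prob p (X₃ ∩ A') := by
    have := prob_mul_prob_le_prob_inter hp hX₃up hA'up
    rwa [← prob_inter_add_prob_inter_compl p X₃ A'] at this
  have hca : prob p (X₀ ∩ A') ≤ prob p (X₁ ∩ A') :=
    prob_mono hp (Set.inter_subset_inter_left _ h01)
  have h1q : 0 ≤ 1 - p f₁ := sub_nonneg.2 (hp.le_one f₁)
  have h1r : 0 ≤ 1 - p f₂ := sub_nonneg.2 (hp.le_one f₂)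
  have h1μ : 0 ≤ 1 - prob p A' := sub_nonneg.2 (prob_le_one hp _)
  have hHar' : 0 ≤ (1 - prob p A') * prob p (X₃ ∩ A') - prob p A' * prob p (X₃ ∩ A'ᶜ) := by
    linarith
  exact mul_nonneg (mul_nonneg (mul_nonneg h1q h1r) h1μ)
    (add_nonneg (mul_nonneg (mul_nonneg (hp.nonneg f₁) h1r) hHar')
      (mul_nonneg (mul_nonneg h1q (hp.nonneg f₂)) (sub_nonneg.2 hca)))

end OTwoEdgeTheorem

end Summit.Ventures.PercRepro2
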